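import Mathlib
import HarnessLib
import Summits.Ventures.LatticeQCDFlow.Exactness.LaggedAdaptationDoeblin
import Summits.Ventures.LatticeQCDFlow.Exactness.IMHDefensiveMixtureCertificate

/-!
# LatticeQCDFlow / Exactness — LEARNING ON THE JOB, VII: ADAPT FREELY INSIDE A DEFENSIVE ENVELOPE — mixing every retrained flow with a
# fraction `ε` of the prior caps every weight by `P/ε`, so the lag bound holds with the SAME rate `(1 − ε/P)^lag` whatever the training did

HONEST FRAMING: exact (Metropolis-corrected) sampling algorithms for lattice gauge theory;
figures of merit are autocorrelation/cost numbers at stated couplings and volumes; no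
continuum-physics claim.

Venture `LatticeQCDFlow` (cell pub-lqcd), topic `Exactness`, FANOUT row 30 (lean-1 GEN-44, theme LEARNING ON THE JOB).  NEW WORK of the
cell; no definition is introduced, nothing is cited as a fact.  Tree inputs: `LaggedAdaptationDoeblin` (`laggedFlowSchedule_real_sub_le`:
a list of frozen flow samplers with weights `≤ M` is within `(1 − M⁻¹)ⁿ` of `π` from every configuration), GEN-41's
`IMHDefensiveMixtureCertificate` (`defensiveWeight_le`: `w_ε = p/((1 − ε)g + ε) ≤ P/ε`; `defensive_target_eq`: `w_ε·q_ε = p·λ`;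
`isProbabilityMeasure_defensive`).  Printed counterparts NAMED ONLY: defensive importance sampling (Hesterberg 1995), the adaptive
independence sampler with a fixed heavy-tailed component (Holden–Hauge–Holden 2009).

## Setting
A prior probability `λ` on `Ω` (Haar on the gauge group's product); a target density `0 < p ≤ P` with `p·λ` a probability; a FAMILY of flow
densities `g(h, ·) ≥ 0`, `∫ g(h, ·) dλ = 1`, jointly measurable in (parameter, configuration) — every flow any training could produce; a
defensive fraction `0 < ε ≤ 1`.  The sampler with parameters `h` proposes from `q_ε(h) = ((1 − ε)g(h, ·) + ε)·λ` and accepts with the ratio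
of `w_ε(h, ·) = p/((1 − ε)g(h, ·) + ε)` — def-free: `q : Kernel H Ω` is any kernel with these sections (`hq`; it exists,
`defensiveFlowKernel_exists`) and `κ` any kernel on `H × Ω` realising `indepMH (q h) (w_ε h)` section-wise (`hκ`).

## Results (no `sorry`)
* §1 `defensiveFamily_weight_props` — for EVERY parameter: `w_ε(h, ·)` measurable, `0 < w_ε(h, ·) ≤ P/ε`, and `w_ε(h, ·)·q_ε(h) = p·λ`
  (every member of the family is an exact flow sampler for the SAME target with the SAME weight cap); `defensiveFamily_isMarkovKernel`;
  `defensiveFlowKernel_exists`.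
* §2 **`defensiveEnvelope_lag_real_sub_le`** — THE DESIGN RULE WITH A THEOREM: for every list `hs` of parameters (the flows used in the last
  `n` updates — produced by ANY training rule from information at least `n` updates old) and every configuration `x` at that time,
  `|δ_x K_{h₁}⋯K_{hₙ}(A) − (p·λ)(A)| ≤ (1 − ε/P)ⁿ` (`defensiveEnvelope_rate_eq`: the rate in closed form).  The rate does not depend on the
  flows: a training run that diverges, collapses onto one sector or oscillates still yields lag-`n` laws within `(1 − ε/P)ⁿ` of the target.
Reading (gauge files): keep a fraction `ε` of heat-bath ∕ Haar proposals in every retrained flow sampler and read configurations `n`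
updates behind the parameters; `P = e^{−S_min}/Z` makes the guaranteed rate exponentially slow in the volume (`Scaling/Barriers`), but it
is a floor under every adaptive variant, not an estimate of any.
-/

noncomputable section

namespace Summit.Ventures.LatticeQCDFlow.Exactness

open MeasureTheory ProbabilityTheory
open scoped _root_.ENNReal

variable {Ω H : Type*} [MeasurableSpace Ω] [MeasurableSpace H] {lam : Measure Ω} [IsProbabilityMeasure lam]
  {g : H → Ω → ℝ} {p : Ω → ℝ} {ε P : ℝ}

/-! ## §1 Every member of the defensive family is an exact, uniformly capped flow sampler -/

omit [IsProbabilityMeasure lam] in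
/-- **UNIFORM PROPERTIES OF THE DEFENSIVE FAMILY**: for every parameter `h`, the weight `w_ε(h, ·) = p/((1 − ε)g(h, ·) + ε)` is measurable,
positive, at most `P/ε`, and `w_ε(h, ·)·q_ε(h) = p·λ`. [ours — GEN-41's pointwise lemmas, parameter by parameter] -/
theorem defensiveFamily_weight_props (hg : Measurable (Function.uncurry g)) (hg0 : ∀ h y, 0 ≤ g h y) (hp : Measurable p)
    (hp0 : ∀ y, 0 < p y) (hpP : ∀ y, p y ≤ P) (hε : 0 < ε) (hε1 : ε ≤ 1) (q : Kernel H Ω)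
    (hq : ∀ h, q h = lam.withDensity fun y => ENNReal.ofReal ((1 - ε) * g h y + ε)) (h : H) :
    Measurable (fun y => p y / ((1 - ε) * g h y + ε)) ∧ (∀ y, 0 < p y / ((1 - ε) * g h y + ε)) ∧
      (∀ y, p y / ((1 - ε) * g h y + ε) ≤ P / ε) ∧
      ((q h).withDensity fun y => ENNReal.ofReal (p y / ((1 - ε) * g h y + ε))) = lam.withDensity fun y => ENNReal.ofReal (p y) := by
  have hgh : Measurable (g h) := hg.comp measurable_prodMk_left
  refine ⟨defensiveWeight_measurable hgh hp ε, fun y => (defensiveWeight_le (hg0 h) hp0 hpP hε hε1 y).1,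
    fun y => (defensiveWeight_le (hg0 h) hp0 hpP hε hε1 y).2, ?_⟩
  rw [hq h]
  exact defensive_target_eq hgh (hg0 h) hp hε hε1

/-- The defensive family is a Markov kernel from parameters to proposals (each `q_ε(h)` is a probability law). [ours, bookkeeping] -/
theorem defensiveFamily_isMarkovKernel (hg : Measurable (Function.uncurry g)) (hg0 : ∀ h y, 0 ≤ g h y)
    (hg1 : ∀ h, IsProbabilityMeasure (lam.withDensity fun y => ENNReal.ofReal (g h y))) (hε : 0 < ε) (hε1 : ε ≤ 1) (q : Kernel H Ω)
    (hq : ∀ h, q h = lam.withDensity fun y => ENNReal.ofReal ((1 - ε) * g h y + ε)) : IsMarkovKernel q := by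
  refine ⟨fun h => ?_⟩
  rw [hq h]
  haveI := hg1 h
  exact isProbabilityMeasure_defensive (hg.comp measurable_prodMk_left) (hg0 h) hε hε1

/-- The hypothesis `hq` can be met: `Kernel.withDensity (const λ)` of the jointly measurable defensive density. [ours, bookkeeping] -/
theorem defensiveFlowKernel_exists (hg : Measurable (Function.uncurry g)) (ε : ℝ) :
    ∃ q : Kernel H Ω, ∀ h, q h = lam.withDensity fun y => ENNReal.ofReal ((1 - ε) * g h y + ε) := by
  have hm : Measurable (Function.uncurry fun (h : H) (y : Ω) => ENNReal.ofReal ((1 - ε) * g h y + ε)) :=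
    ((hg.const_mul _).add_const _).ennreal_ofReal
  exact ⟨Kernel.withDensity (Kernel.const H lam) fun h y => ENNReal.ofReal ((1 - ε) * g h y + ε), fun h => by
    rw [Kernel.withDensity_apply _ hm, Kernel.const_apply]⟩

/-! ## §2 The lag bound with a training-independent rate -/

/-- **ADAPT FREELY INSIDE A DEFENSIVE ENVELOPE**: for every list of parameters `hs` and every configuration `x`,
`|δ_x K_{h₁}⋯K_{hₙ}(A) − (p·λ)(A)| ≤ (1 − (P/ε)⁻¹)ⁿ` — the flows `g(hᵢ, ·)` are arbitrary members of the family. [ours] -/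
theorem defensiveEnvelope_lag_real_sub_le (hg : Measurable (Function.uncurry g)) (hg0 : ∀ h y, 0 ≤ g h y)
    (hg1 : ∀ h, IsProbabilityMeasure (lam.withDensity fun y => ENNReal.ofReal (g h y))) (hp : Measurable p) (hp0 : ∀ y, 0 < p y)
    (hpP : ∀ y, p y ≤ P) [IsProbabilityMeasure (lam.withDensity fun y => ENNReal.ofReal (p y))] (hε : 0 < ε) (hε1 : ε ≤ 1)
    (q : Kernel H Ω) (hq : ∀ h, q h = lam.withDensity fun y => ENNReal.ofReal ((1 - ε) * g h y + ε)) (κ : Kernel (H × Ω) Ω)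
    (hκ : ∀ (h : H) (x : Ω) {B : Set Ω}, MeasurableSet B → κ (h, x) B =
      ∫⁻ y in B, imhAcceptE (fun y => p y / ((1 - ε) * g h y + ε)) x y ∂(q h) +
        (1 - imhAcceptMass (q h) (fun y => p y / ((1 - ε) * g h y + ε)) x) * B.indicator 1 x)
    (hs : List H) (x : Ω) (A : Set Ω) :
    |((hs.map fun h => κ.comap (Prod.mk h) measurable_prodMk_left).foldl (fun (m : Measure Ω) (K : Kernel Ω Ω) => m.bind K)
        (Measure.dirac x)).real A - (lam.withDensity fun y => ENNReal.ofReal (p y)).real A|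
      ≤ (1 - (ENNReal.ofReal (P / ε))⁻¹.toReal) ^ hs.length := by
  haveI := defensiveFamily_isMarkovKernel hg hg0 hg1 hε hε1 q hq
  have hP := defensiveFamily_weight_props hg hg0 hp hp0 hpP hε hε1 q hq
  exact laggedFlowSchedule_real_sub_le (π := lam.withDensity fun y => ENNReal.ofReal (p y))
    (w := fun h y => p y / ((1 - ε) * g h y + ε)) q (fun h => (hP h).1) (fun h => (hP h).2.1) (fun h => (hP h).2.2.1)
    (fun h => (hP h).2.2.2) κ hκ hs x A

omit [MeasurableSpace Ω] [IsProbabilityMeasure lam] in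
/-- **THE RATE IN CLOSED FORM**: `1 − (ofReal (P/ε))⁻¹ = 1 − ε/P` for `P, ε > 0`. [ours, bookkeeping] -/
theorem defensiveEnvelope_rate_eq (hP : 0 < P) (hε : 0 < ε) : 1 - (ENNReal.ofReal (P / ε))⁻¹.toReal = 1 - ε / P := by
  rw [inv_ofReal_toReal (div_pos hP hε), inv_div]

/-- **… HENCE `|δ_x K_{h₁}⋯K_{hₙ}(A) − π(A)| ≤ (1 − ε/P)ⁿ`** for every parameter history and every configuration. [ours] -/
theorem defensiveEnvelope_lag_real_sub_le' (hg : Measurable (Function.uncurry g)) (hg0 : ∀ h y, 0 ≤ g h y)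
    (hg1 : ∀ h, IsProbabilityMeasure (lam.withDensity fun y => ENNReal.ofReal (g h y))) (hp : Measurable p) (hp0 : ∀ y, 0 < p y)
    (hpP : ∀ y, p y ≤ P) [IsProbabilityMeasure (lam.withDensity fun y => ENNReal.ofReal (p y))] (hε : 0 < ε) (hε1 : ε ≤ 1)
    (q : Kernel H Ω) (hq : ∀ h, q h = lam.withDensity fun y => ENNReal.ofReal ((1 - ε) * g h y + ε)) (κ : Kernel (H × Ω) Ω)
    (hκ : ∀ (h : H) (x : Ω) {B : Set Ω}, MeasurableSet B → κ (h, x) B =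
      ∫⁻ y in B, imhAcceptE (fun y => p y / ((1 - ε) * g h y + ε)) x y ∂(q h) +
        (1 - imhAcceptMass (q h) (fun y => p y / ((1 - ε) * g h y + ε)) x) * B.indicator 1 x)
    (hs : List H) (x : Ω) (A : Set Ω) :
    |((hs.map fun h => κ.comap (Prod.mk h) measurable_prodMk_left).foldl (fun (m : Measure Ω) (K : Kernel Ω Ω) => m.bind K)
        (Measure.dirac x)).real A - (lam.withDensity fun y => ENNReal.ofReal (p y)).real A|
      ≤ (1 - ε / P) ^ hs.length := by
  obtain ⟨y⟩ := nonempty_of_isProbabilityMeasure lam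
  have hPpos : 0 < P := (hp0 y).trans_le (hpP y)
  rw [← defensiveEnvelope_rate_eq hPpos hε]
  exact defensiveEnvelope_lag_real_sub_le hg hg0 hg1 hp hp0 hpP hε hε1 q hq κ hκ hs x A

end Summit.Ventures.LatticeQCDFlow.Exactness
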